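import Mathlib.Analysis.Analytic.Uniqueness
import Mathlib.Analysis.Analytic.Constructions
import Mathlib.Analysis.Complex.Basic
import Mathlib.Analysis.Complex.Polynomial.Basic
import Mathlib.Algebra.Polynomial.Div
import HarnessLib

/-!
# Factorisation of analytic families of polynomials along analytic root functions

Let `V` be an open connected subset of a real normed space, `Ω ⊆ V` open and non-empty, and
`ζ₁, …, ζₙ : V → ℂ` real-analytic functions ("root functions", e.g. the roots of a monic
polynomial with analytic coefficients after Abhyankar–Jung ramification).

* `exists_isOpen_eqOn_zero_of_forall_exists` — a finite family of functions continuous on a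
  non-empty open `Ω`, one of which vanishes at each point of `Ω`, has a member vanishing on a
  non-empty open subset of `Ω` (elementary: remove the members one at a time).
* `exists_eqOn_of_forall_exists_eq` — **selection**: an analytic `g : V → ℂ` which at every point
  of `Ω` coincides with some `ζ_l` coincides with one fixed `ζ_l` on all of `V` (the previous lemma
  and the identity principle).
* `exists_eq_prod_pow_of_roots_subset` — **factorisation**: a family `σ ↦ P_σ ∈ ℂ[T]` of monic
  polynomials of constant degree with coefficients analytic on `V`, all of whose roots over points
  of `Ω` are among the `ζ_l`, is `∏_l (T − ζ_l σ)^{k_l}` on `V` for constant exponents `k_l`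
  (induction on the degree: select a root function, divide it out).

These are the bookkeeping steps by which, in Jung's method, every factor of a discriminant-prepared
polynomial acquires constant multiplicities along the analytic roots.

## References

* H. W. E. Jung, J. reine angew. Math. 133 (1908), 289–314.
* J. Kollár, *Lectures on Resolution of Singularities* (2007), §2.3.
* A. Parusiński, G. Rond, The Abhyankar–Jung theorem, J. Algebra 365 (2012), 29–41.
-/

noncomputable section

open Set Filter Polynomial
open scoped Topology

namespace Literature.Analysis.Calculus

section Cover

variable {X Y : Type*} [TopologicalSpace X] [TopologicalSpace Y] [T1Space Y] [Zero Y]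

/-- **A finite cover by zero sets has a member with interior.** If finitely many functions
`f_l`, continuous on a non-empty open set `Ω`, are such that at every point of `Ω` one of them
vanishes, then one of them vanishes on a non-empty open subset of `Ω`. [folklore] -/
theorem exists_isOpen_eqOn_zero_of_forall_exists {n : ℕ} {Ω : Set X} (hΩ : IsOpen Ω)
    (hne : Ω.Nonempty) (f : Fin n → X → Y) (hf : ∀ l, ContinuousOn (f l) Ω)
    (hcov : ∀ σ ∈ Ω, ∃ l, f l σ = 0) :
    ∃ l, ∃ U : Set X, IsOpen U ∧ U.Nonempty ∧ U ⊆ Ω ∧ ∀ σ ∈ U, f l σ = 0 := by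
  induction n generalizing Ω with
  | zero =>
    obtain ⟨σ, hσ⟩ := hne
    obtain ⟨l, -⟩ := hcov σ hσ
    exact l.elim0
  | succ n ih =>
    by_cases hlast : ∀ σ ∈ Ω, f (Fin.last n) σ = 0
    · exact ⟨Fin.last n, Ω, hΩ, hne, Subset.rfl, hlast⟩
    · push Not at hlast
      obtain ⟨σ₀, hσ₀, hσ₀ne⟩ := hlast
      set Ω' : Set X := Ω ∩ f (Fin.last n) ⁻¹' {0}ᶜ with hΩ'
      have hΩ'open : IsOpen Ω' := (hf (Fin.last n)).isOpen_inter_preimage hΩ isOpen_compl_singleton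
      have hΩ'sub : Ω' ⊆ Ω := inter_subset_left
      obtain ⟨l, U, hU, hUne, hUΩ', hUz⟩ := ih (Ω := Ω') hΩ'open ⟨σ₀, hσ₀, hσ₀ne⟩
        (fun l => f (Fin.castSucc l)) (fun l => (hf _).mono hΩ'sub) (fun σ hσ => by
          obtain ⟨l, hl⟩ := hcov σ (hΩ'sub hσ)
          refine ⟨l.castPred fun h => hσ.2 (by rw [← h]; exact hl), ?_⟩
          simpa using hl)
      exact ⟨Fin.castSucc l, U, hU, hUne, hUΩ'.trans hΩ'sub, hUz⟩

end Cover

section Selection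

variable {E : Type*} [NormedAddCommGroup E] [NormedSpace ℝ E]

/-- **Selection of a root function.** Let `V` be preconnected, `Ω ⊆ V` open and non-empty,
`ζ_l : V → ℂ` (`l < n`) and `g : V → ℂ` real-analytic on `V`. If at every point of `Ω` the value of
`g` is one of the values `ζ_l σ`, then `g = ζ_l` on `V` for one fixed `l` (the zero sets of the
`g − ζ_l` cover `Ω`, so one of them has interior; identity principle). [folklore] -/
theorem exists_eqOn_of_forall_exists_eq {V Ω : Set E} (hV : IsPreconnected V) (hΩV : Ω ⊆ V)
    (hΩ : IsOpen Ω) (hne : Ω.Nonempty) {n : ℕ} {ζ : Fin n → E → ℂ}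
    (hζ : ∀ l, AnalyticOnNhd ℝ (ζ l) V) {g : E → ℂ} (hg : AnalyticOnNhd ℝ g V)
    (hcov : ∀ σ ∈ Ω, ∃ l, g σ = ζ l σ) : ∃ l, EqOn g (ζ l) V := by
  obtain ⟨l, U, hU, ⟨z₀, hz₀⟩, hUΩ, hUz⟩ := exists_isOpen_eqOn_zero_of_forall_exists hΩ hne
    (fun l σ => g σ - ζ l σ)
    (fun l => ((hg.continuousOn.mono hΩV).sub ((hζ l).continuousOn.mono hΩV)))
    (fun σ hσ => by
      obtain ⟨l, hl⟩ := hcov σ hσ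
      exact ⟨l, sub_eq_zero.2 hl⟩)
  refine ⟨l, fun σ hσ => sub_eq_zero.1 ?_⟩
  have h := (hg.sub (hζ l)).eqOn_zero_of_preconnected_of_eventuallyEq_zero hV (hΩV (hUΩ hz₀))
    (eventually_of_mem (hU.mem_nhds hz₀) fun σ hσ => hUz σ hσ)
  exact h hσ

end Selection

section Factorisation

variable {E : Type*} [NormedAddCommGroup E] [NormedSpace ℝ E]

/-- Evaluating a family of polynomials of bounded degree with analytic coefficients at an analytic
function gives an analytic function. [folklore] -/
theorem analyticOnNhd_eval_of_coeff {V : Set E} (hVo : IsOpen V) {P : E → ℂ[X]} {N : ℕ}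
    (hdeg : ∀ σ ∈ V, (P σ).natDegree ≤ N) (hcoeff : ∀ k, AnalyticOnNhd ℝ (fun σ => (P σ).coeff k) V)
    {g : E → ℂ} (hg : AnalyticOnNhd ℝ g V) :
    AnalyticOnNhd ℝ (fun σ => (P σ).eval (g σ)) V := by
  intro σ hσ
  have heq : (fun σ => (P σ).eval (g σ)) =ᶠ[𝓝 σ]
      fun σ => ∑ i ∈ Finset.range (N + 1), (P σ).coeff i * g σ ^ i :=
    eventually_of_mem (hVo.mem_nhds hσ) fun τ hτ =>
      eval_eq_sum_range' (Nat.lt_succ_of_le (hdeg τ hτ)) _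
  refine AnalyticAt.congr ?_ heq.symm
  exact Finset.analyticAt_fun_sum _ fun i _ => (hcoeff i σ hσ).mul ((hg σ hσ).pow i)

/-- Dividing a monic family with analytic coefficients by a linear factor `T − g σ` along an
analytic root function `g` gives a monic family with analytic coefficients. [folklore] -/
theorem analyticOnNhd_coeff_divByMonic {V : Set E} (hVo : IsOpen V) {P : E → ℂ[X]} {N : ℕ}
    (hdeg : ∀ σ ∈ V, (P σ).natDegree = N) (hcoeff : ∀ k, AnalyticOnNhd ℝ (fun σ => (P σ).coeff k) V)
    {g : E → ℂ} (hg : AnalyticOnNhd ℝ g V) (k : ℕ) :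
    AnalyticOnNhd ℝ (fun σ => ((P σ) /ₘ (X - C (g σ))).coeff k) V := by
  intro σ hσ
  have heq : (fun σ => ((P σ) /ₘ (X - C (g σ))).coeff k) =ᶠ[𝓝 σ]
      fun σ => ∑ i ∈ Finset.Icc (k + 1) N, g σ ^ (i - (k + 1)) * (P σ).coeff i :=
    eventually_of_mem (hVo.mem_nhds hσ) fun τ hτ => by
      simp only [coeff_divByMonic_X_sub_C, hdeg τ hτ]
  refine AnalyticAt.congr ?_ heq.symm
  exact Finset.analyticAt_fun_sum _ fun i _ => ((hg σ hσ).pow _).mul (hcoeff i σ hσ)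

/-- **Factorisation along analytic root functions.** Let `V` be open and preconnected,
`Ω ⊆ V` open and non-empty, `ζ_l : V → ℂ` real-analytic, and `σ ↦ P_σ ∈ ℂ[T]` a family of monic
polynomials of constant degree `N` whose coefficients are real-analytic on `V`. If for every
`σ ∈ Ω` all roots of `P_σ` are among the `ζ_l σ`, then there are exponents `k_l ∈ ℕ` with
`P_σ = ∏_l (T − ζ_l σ)^{k_l}` for ALL `σ ∈ V`. (Induction on `N`: the zero sets of
`σ ↦ P_σ(ζ_l σ)` cover `Ω`, so one root function is a root identically on `V` by the identity
principle; divide it out.) [folklore] -/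
theorem exists_eq_prod_pow_of_roots_subset {V Ω : Set E} (hVo : IsOpen V) (hV : IsPreconnected V)
    (hΩV : Ω ⊆ V) (hΩ : IsOpen Ω) (hne : Ω.Nonempty) {n : ℕ} {ζ : Fin n → E → ℂ}
    (hζ : ∀ l, AnalyticOnNhd ℝ (ζ l) V) :
    ∀ (N : ℕ) (P : E → ℂ[X]), (∀ σ ∈ V, (P σ).Monic) → (∀ σ ∈ V, (P σ).natDegree = N) →
      (∀ k, AnalyticOnNhd ℝ (fun σ => (P σ).coeff k) V) →
      (∀ σ ∈ Ω, ∀ t : ℂ, (P σ).IsRoot t → ∃ l, t = ζ l σ) →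
      ∃ k : Fin n → ℕ, ∀ σ ∈ V, P σ = ∏ l, (X - C (ζ l σ)) ^ k l := by
  classical
  intro N
  induction N with
  | zero =>
    intro P hmonic hdeg _ _
    refine ⟨fun _ => 0, fun σ hσ => ?_⟩
    simp only [pow_zero, Finset.prod_const_one]
    exact Polynomial.eq_one_of_monic_natDegree_zero (hmonic σ hσ) (hdeg σ hσ)
  | succ N ih =>
    intro P hmonic hdeg hcoeff hroots
    -- one root function is a root identically
    have hev : ∀ l, AnalyticOnNhd ℝ (fun σ => (P σ).eval (ζ l σ)) V := fun l =>
      analyticOnNhd_eval_of_coeff hVo (fun σ hσ => (hdeg σ hσ).le) hcoeff (hζ l)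
    obtain ⟨l₀, U, hU, ⟨z₀, hz₀⟩, hUΩ, hUz⟩ := exists_isOpen_eqOn_zero_of_forall_exists hΩ hne
      (fun l σ => (P σ).eval (ζ l σ)) (fun l => (hev l).continuousOn.mono hΩV) (fun σ hσ => by
        have hdeg' : (P σ).degree ≠ 0 := by
          rw [degree_eq_natDegree (hmonic σ (hΩV hσ)).ne_zero, hdeg σ (hΩV hσ)]
          exact_mod_cast Nat.succ_ne_zero N
        obtain ⟨t, ht⟩ := IsAlgClosed.exists_root (P σ) hdeg'
        obtain ⟨l, rfl⟩ := hroots σ hσ t ht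
        exact ⟨l, ht⟩)
    have hroot : ∀ σ ∈ V, (P σ).IsRoot (ζ l₀ σ) := fun σ hσ =>
      (hev l₀).eqOn_zero_of_preconnected_of_eventuallyEq_zero hV (hΩV (hUΩ hz₀))
        (eventually_of_mem (hU.mem_nhds hz₀) fun σ hσ => hUz σ hσ) hσ
    -- divide it out
    set P' : E → ℂ[X] := fun σ => (P σ) /ₘ (X - C (ζ l₀ σ)) with hP'
    have hmul : ∀ σ ∈ V, (X - C (ζ l₀ σ)) * P' σ = P σ := fun σ hσ =>
      mul_divByMonic_eq_iff_isRoot.2 (hroot σ hσ)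
    have hdeg' : ∀ σ ∈ V, (P' σ).natDegree = N := fun σ hσ => by
      rw [hP', natDegree_divByMonic _ (monic_X_sub_C _), hdeg σ hσ, natDegree_X_sub_C]
      rfl
    have hmonic' : ∀ σ ∈ V, (P' σ).Monic := fun σ hσ => by
      have h := (hmonic σ hσ).leadingCoeff
      rw [← hmul σ hσ, leadingCoeff_mul, (monic_X_sub_C _).leadingCoeff, one_mul] at h
      exact h
    have hcoeff' : ∀ k, AnalyticOnNhd ℝ (fun σ => (P' σ).coeff k) V := fun k =>
      analyticOnNhd_coeff_divByMonic hVo hdeg hcoeff (hζ l₀) k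
    have hroots' : ∀ σ ∈ Ω, ∀ t : ℂ, (P' σ).IsRoot t → ∃ l, t = ζ l σ := fun σ hσ t ht =>
      hroots σ hσ t (by
        rw [IsRoot.def, ← hmul σ (hΩV hσ), eval_mul, IsRoot.def.1 ht, mul_zero])
    obtain ⟨k, hk⟩ := ih P' hmonic' hdeg' hcoeff' hroots'
    refine ⟨Function.update k l₀ (k l₀ + 1), fun σ hσ => ?_⟩
    rw [← hmul σ hσ, hk σ hσ, ← Finset.mul_prod_erase _ _ (Finset.mem_univ l₀),
      ← Finset.mul_prod_erase _ _ (Finset.mem_univ l₀), Function.update_self, pow_succ', mul_assoc]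
    congr 2
    exact Finset.prod_congr rfl fun l hl => by
      rw [Function.update_of_ne (Finset.ne_of_mem_erase hl)]

end Factorisation

end Literature.Analysis.Calculus
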